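import Summits.ValiantsHypothesis.ValiantsHypothesis.Theorems.GrenetZeonDualUnipotentThreeHalvesHeavyTopWeightThinBlocks

/-!
# val-idea-26 g2 (lens (a)) — BAND / HESSENBERG-DEPTH certificate for R2's transferred crux C⁺ = `UniformWeightLaw`
(crux stmt-ValiantsHypothesis-24318; line α `Lines/krylov_seed.lean`).  STATEMENTS ONLY (planner sketch; `sorry` on the one theorem).

`IsBanded D P N` : after the constant change of basis `P`, every entry of the affine pencil strictly more than `D` places below the
diagonal vanishes (`D = 0` = simultaneously upper-triangularised incl. diagonal… we use the STRICT form `j + D < i ⇒ 0`, so `D = 0` is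
"upper triangular with diagonal allowed"; the tree's D♯ hypothesis `j ≤ i ⇒ 0` is the strictly-upper case and implies `IsBanded 0`).
`weightThin_of_band_levels` : consecutive blocks of size `h` (levels antitone in the index, as in ✓ `weightThin_of_triangularisable_sharp`),
drop `r = D / h + 1`, climb `c`, `K` = tops vanishing on the band `i ≤ j + D ∧ j < i + c·h` (at most `m·(D + c·h)` coordinates) give
`WeightThin n m N` under the displayed budget.  `BandLaw` : the asymptotic form (feasible, by optimising `h` and `c = r`, whenever
`16·(m² + D·m·n) < n³`, in particular for every depth `D < n²/(16 m)` once `32 m² < n³`).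
Honest framing: a certificate schema extending D♯ from one-way (triangular) to two-way banded pencils; NOTHING here proves
`UniformWeightLaw`, R2 `HeavyTopLaw`, 24318 or VP ≠ VNP (all OPEN / NOT proved).
-/

set_option linter.dupNamespace false
set_option autoImplicit false

noncomputable section

namespace Summit.ValiantsHypothesis.ValiantsHypothesis.Cruxes.DualUnipotentThreeHalves.BandDepth

open MvPolynomial Matrix
open Summit.ValiantsHypothesis.ValiantsHypothesis.Cruxes.TwoDimCoefficients.DimTwoCases (AffMat IsAffine)
open Summit.ValiantsHypothesis.ValiantsHypothesis.Theorems.GrenetZeon.RadicalSplit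
open Summit.ValiantsHypothesis.ValiantsHypothesis.Theorems.GrenetZeon.KrylovSeed

variable {m : ℕ}

/-- The affine pencil is `D`-banded below the diagonal after the constant change of basis `P`
(upper `D`-Hessenberg shape: entry `(i,j)` vanishes when `j + D < i`). -/
def IsBanded {n : ℕ} (D : ℕ) (P : (Matrix (Fin m) (Fin m) ℂ)ˣ) (N : AffMat n m) : Prop :=
  ∀ i j : Fin m, (j : ℕ) + D < i →
    ((P : Matrix (Fin m) (Fin m) ℂ).map C * N * (↑P⁻¹ : Matrix (Fin m) (Fin m) ℂ).map C : AffMat n m) i j = 0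

/-- Hessenberg depth at most `D`: some constant basis makes the whole pencil `D`-banded below the diagonal. -/
def DepthLE {n : ℕ} (D : ℕ) (N : AffMat n m) : Prop :=
  ∃ P : (Matrix (Fin m) (Fin m) ℂ)ˣ, IsBanded D P N

/-- D♯'s hypothesis (strictly upper after `P`) is the depth-`0` case. -/
theorem isBanded_zero_of_strictUpper {n : ℕ} (N : AffMat n m) (P : (Matrix (Fin m) (Fin m) ℂ)ˣ)
    (htri : ∀ i j : Fin m, j ≤ i →
      ((P : Matrix (Fin m) (Fin m) ℂ).map C * N * (↑P⁻¹ : Matrix (Fin m) (Fin m) ℂ).map C : AffMat n m) i j = 0) :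
    IsBanded 0 P N := by
  intro i j hij
  exact htri i j (by rw [Nat.add_zero] at hij; exact le_of_lt (Fin.lt_def.mpr hij))

/-- ★ (statement; port task S–M, proof = ✓ `weightThin_of_triangularisable_sharp` with drop `r = D/h + 1` and the band
coordinate count `m·(D + c·h)` in place of `card_sameBlock_pairs_le`).  BAND LEVELS ARE WEIGHT LEVELS. -/
theorem weightThin_of_band_levels {n : ℕ} (N : AffMat n m) (hN : IsAffine N)
    (P : (Matrix (Fin m) (Fin m) ℂ)ˣ) (D : ℕ) (hband : IsBanded D P N)
    (h c : ℕ) (hh : 1 ≤ h) (hc : 1 ≤ c)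
    (hbudget : (((m - 1) / h + (D / h + 1) * (n - 1)) / (c + (D / h + 1)) + 1) * n + m * (D + c * h) < n ^ 2) :
    WeightThin n m N := by
  classical
  -- consecutive block levels of size `h`, antitone in the index
  obtain ⟨lvl, hlvl⟩ : ∃ lvl : Fin m → ℕ, ∀ i, lvl i = (m - 1 - (i : ℕ)) / h := ⟨_, fun _ => rfl⟩
  have hpos : 0 < h := hh
  -- drop bound: inside the band the level can decrease by at most `D / h + 1`
  have hdrop : ∀ i j : Fin m, (i : ℕ) ≤ j + D → lvl j ≤ lvl i + (D / h + 1) := by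
    intro i j hij
    rw [hlvl, hlvl]
    have h1 : m - 1 - (j : ℕ) ≤ (m - 1 - (i : ℕ)) + D := by omega
    have h2 : ((m - 1 - (i : ℕ)) + D) / h ≤ (m - 1 - (i : ℕ)) / h + D / h + 1 := by
      rw [Nat.add_div hpos]
      split_ifs <;> omega
    exact le_trans (Nat.div_le_div_right h1) (by omega)
  -- climb bound: `c·h` places above the diagonal the level has increased by at least `c`
  have hclimb : ∀ i j : Fin m, (i : ℕ) + c * h ≤ j → lvl j + c ≤ lvl i := by
    intro i j hij
    rw [hlvl, hlvl]
    have h1 : (m - 1 - (j : ℕ)) + c * h ≤ m - 1 - (i : ℕ) := by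
      have := j.isLt
      omega
    have h2 : ((m - 1 - (j : ℕ)) + c * h) / h = (m - 1 - (j : ℕ)) / h + c := Nat.add_mul_div_right _ _ hpos
    have h3 := Nat.div_le_div_right (c := h) h1
    rw [h2] at h3
    exact h3
  -- the conjugated top as a linear map, and its band coordinates
  obtain ⟨T, hT⟩ : ∃ T : (Fin n × Fin n → ℂ) →ₗ[ℂ] Matrix (Fin m) (Fin m) ℂ, ∀ v,
      T v = (P : Matrix (Fin m) (Fin m) ℂ) * linPart N v * (↑P⁻¹ : Matrix (Fin m) (Fin m) ℂ) := by
    obtain ⟨T₀, hT₀⟩ := exists_topMap_linPart N hN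
    refine ⟨(LinearMap.mulRight ℂ (↑P⁻¹ : Matrix (Fin m) (Fin m) ℂ)).comp
      ((LinearMap.mulLeft ℂ (P : Matrix (Fin m) (Fin m) ℂ)).comp T₀), fun v => ?_⟩
    simp [hT₀, Matrix.mul_assoc]
  obtain ⟨L', hL'⟩ : ∃ L' : (Fin n × Fin n → ℂ) →ₗ[ℂ]
      ({q : Fin m × Fin m // (q.1 : ℕ) ≤ q.2 + D ∧ (q.2 : ℕ) < q.1 + c * h} → ℂ), ∀ v q, L' v q = T v q.1.1 q.1.2 := by
    refine ⟨LinearMap.pi fun q => ?_, fun v q => ?_⟩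
    · exact { toFun := fun v => T v q.1.1 q.1.2
              map_add' := fun v w => by rw [map_add, Matrix.add_apply]
              map_smul' := fun a v => by rw [map_smul, Matrix.smul_apply, smul_eq_mul, RingHom.id_apply, smul_eq_mul] }
    · rfl
  -- the band has at most `m·(D + c·h)` coordinates
  have hcard : Fintype.card {q : Fin m × Fin m // (q.1 : ℕ) ≤ q.2 + D ∧ (q.2 : ℕ) < q.1 + c * h} ≤ m * (D + c * h) := by
    let F : {q : Fin m × Fin m // (q.1 : ℕ) ≤ q.2 + D ∧ (q.2 : ℕ) < q.1 + c * h} → Fin m × Fin (D + c * h) :=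
      fun q => (q.1.1, ⟨(q.1.2 : ℕ) + D - q.1.1, by obtain ⟨h1, h2⟩ := q.2; omega⟩)
    have hF : Function.Injective F := by
      rintro ⟨⟨i, j⟩, hi, hj⟩ ⟨⟨i', j'⟩, hi', hj'⟩ hq
      simp only [F, Prod.mk.injEq, Fin.mk.injEq] at hq
      obtain ⟨hq1, hq2⟩ := hq
      have e1 : (i : ℕ) = i' := by rw [hq1]
      have e2 : j = j' := Fin.ext (by simp only at hi hi' hq2; omega)
      exact Subtype.ext (Prod.ext hq1 e2)
    have := Fintype.card_le_of_injective F hF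
    rwa [Fintype.card_prod, Fintype.card_fin, Fintype.card_fin] at this
  refine ⟨P, lvl, (m - 1) / h + 1, D / h + 1, c, LinearMap.ker L', hc, fun i => ?_, fun i j hij => ?_,
    fun v hv i j hij => ?_, ?_⟩
  · rw [hlvl]; exact Nat.lt_succ_of_le (Nat.div_le_div_right (by omega))
  · -- drop: a level drop of more than `r` forces an entry below the band
    by_cases hb : (j : ℕ) + D < i
    · exact hband i j hb
    · exfalso
      have := hdrop i j (by omega)
      omega
  · -- climb on `K = ker L'`
    by_cases hb : (j : ℕ) + D < i
    · exact conj_linPart_apply_eq_zero N _ _ i j (hband i j hb) v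
    · by_cases hq : (j : ℕ) < i + c * h
      · have hb' : (i : ℕ) ≤ (j : ℕ) + D := not_lt.mp hb
        have h0 := congr_fun (LinearMap.mem_ker.mp hv) ⟨(i, j), hb', hq⟩
        rw [hL', Pi.zero_apply] at h0
        rw [← hT v]; exact h0
      · exfalso
        have := hclimb i j (by omega)
        omega
  · -- dimension
    have h1 := LinearMap.finrank_range_add_finrank_ker L'
    have h2 : Module.finrank ℂ (LinearMap.range L') ≤
        Fintype.card {q : Fin m × Fin m // (q.1 : ℕ) ≤ q.2 + D ∧ (q.2 : ℕ) < q.1 + c * h} := by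
      have := Submodule.finrank_le (LinearMap.range L')
      rwa [Module.finrank_fintype_fun_eq_card] at this
    have h3 : Module.finrank ℂ (Fin n × Fin n → ℂ) = n * n := by
      rw [Module.finrank_fintype_fun_eq_card, Fintype.card_prod, Fintype.card_fin]
    have h4 : n ^ 2 = n * n := sq n
    have h5 : (m - 1) / h + 1 - 1 = (m - 1) / h := Nat.add_sub_cancel _ _
    rw [h5]
    omega

/-- The asymptotic BAND LAW (C⁺ on the shallow locus): a constant `C₀` such that depth `D` with `C₀·(m² + D·m·n) < n³` forces
`WeightThin`.  Provable from `weightThin_of_band_levels` with `h ≈ √(n(m + D n)/m)`-type choices (`C₀ = 16` suffices on paper). -/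
def BandLaw : Prop :=
  ∃ C₀ n₀ : ℕ, ∀ n ≥ n₀, ∀ m D : ℕ, C₀ * (m ^ 2 + D * m * n) < n ^ 3 →
    ∀ N : AffMat n m, IsAffine N → DepthLE D N → WeightThin n m N


/-- **The band law holds** (constants `C₀ = 64`, `n₀ = 64`; paper-optimal constant is `4(1+o(1))`,
numerically `6` suffices for `n ≥ 8`).  In the regime `64·(m² + D·m·n) < n³` every affine pencil of
Hessenberg depth `≤ D` is weight-thin: take block size `h = D + m/n + 1` (so `D/h = 0`, drop `1`) and
climb `c = 3` in `weightThin_of_band_levels`. -/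
theorem bandLaw_holds : BandLaw := by
  refine ⟨64, 64, ?_⟩
  intro n hn m D hreg N hN hdepth
  obtain ⟨P, hband⟩ := hdepth
  have hn0 : 0 < n := by omega
  -- consequences of the regime hypothesis
  have hm2 : 64 * m ^ 2 < n ^ 3 := by nlinarith [hreg, Nat.zero_le (D * m * n)]
  have hDm : 64 * (m * D) < n ^ 2 := by
    have h1 : 64 * (m * D) * n < n ^ 2 * n := by nlinarith [hreg, Nat.zero_le (m ^ 2)]
    exact Nat.lt_of_mul_lt_mul_right h1
  have hmn : 64 * (m * (m / n)) < n ^ 2 := by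
    have h1 : m * (m / n) ≤ m * m / n := Nat.mul_div_le_mul_div_assoc m m n
    have h2 : 64 * (m * m / n) ≤ 64 * (m * m) / n := Nat.mul_div_le_mul_div_assoc 64 (m * m) n
    have h3 : 64 * (m * m) / n < n ^ 2 := by
      rw [Nat.div_lt_iff_lt_mul hn0]
      calc 64 * (m * m) = 64 * m ^ 2 := by ring
        _ < n ^ 3 := hm2
        _ = n ^ 2 * n := by ring
    omega
  have hm : 64 * m < n ^ 2 := by
    by_contra hcon'
    have hcon : n ^ 2 ≤ 64 * m := not_lt.mp hcon'
    have h4 : n ^ 2 * n ^ 2 ≤ 64 * m * (64 * m) := Nat.mul_le_mul hcon hcon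
    have h5 : 64 * n ^ 3 ≤ n * n ^ 3 := Nat.mul_le_mul_right (n ^ 3) hn
    nlinarith [h4, h5, hm2]
  have hn2 : 64 * n ≤ n ^ 2 := by nlinarith [hn]
  -- parameters: block size `h`, climb `3`
  set h := D + m / n + 1 with hh_def
  have hh1 : 1 ≤ h := Nat.le_add_left 1 (D + m / n)
  have hDh : D / h = 0 := Nat.div_eq_of_lt (Nat.lt_succ_of_le (Nat.le_add_right D (m / n)))
  have hm1 : (m - 1) / h ≤ n - 1 := by
    have hlt : m < m / n * n + n := Nat.lt_div_mul_add hn0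
    have hnh : n * h = n * D + m / n * n + n := by rw [hh_def]; ring
    have : (m - 1) / h < n := by
      rw [Nat.div_lt_iff_lt_mul (by omega)]
      omega
    omega
  have hq : 2 * (((m - 1) / h + (D / h + 1) * (n - 1)) / (3 + (D / h + 1))) ≤ n - 1 := by
    simp only [hDh, zero_add, one_mul, Nat.reduceAdd]
    have := Nat.div_mul_le_self ((m - 1) / h + (n - 1)) 4
    omega
  have hmass : m * (D + 3 * h) = 4 * (m * D) + 3 * (m * (m / n)) + 3 * m := by
    rw [hh_def]; ring
  refine weightThin_of_band_levels N hN P D hband h 3 hh1 (by norm_num) ?_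
  set q := ((m - 1) / h + (D / h + 1) * (n - 1)) / (3 + (D / h + 1)) with hq_def
  have hqn : (q + 1) * n * 2 ≤ (n + 1) * n := by
    have h2 : (q + 1) * 2 ≤ n + 1 := by omega
    calc (q + 1) * n * 2 = ((q + 1) * 2) * n := by ring
      _ ≤ (n + 1) * n := Nat.mul_le_mul_right n h2
  rw [hmass]
  nlinarith [hqn, hDm, hmn, hm, hn2]

end Summit.ValiantsHypothesis.ValiantsHypothesis.Cruxes.DualUnipotentThreeHalves.BandDepth

end
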